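import Mathlib.RingTheory.Polynomial.Resultant.Basic
import Mathlib.RingTheory.Polynomial.GaussLemma
import Mathlib.RingTheory.Localization.FractionRing
import Mathlib.Algebra.Polynomial.Bivariate
import Mathlib.Algebra.Polynomial.Roots
import Mathlib.RingTheory.MvPolynomial.Basic
import HarnessLib

/-!
# A weak Bézout bound for plane curves, by elimination

For a field `k` and `F, G ∈ k[x, y]` with `F` irreducible and `F ∤ G`, the set of common zeros
of `F` and `G` in `k²` is finite, of cardinality at most `(deg F + deg G)⁴`
(`mv_commonZeros_finite_ncard_le`, for `MvPolynomial (Fin 2) k` and the total degree;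
`commonZeros_finite_ncard_le` for `k[X][Y]` with separate degree bounds in the two variables).

Bézout's theorem gives the sharp bound `deg F · deg G`; the weaker polynomial bound proved here
is what elimination theory gives directly and is sufficient wherever only *some* bound depending
polynomially on the degrees is needed — in particular for the `N^{1/d+ε}` form of the
Bombieri–Pila theorem (`Literature/NumberTheory/DiophantineGeometry/BombieriPilaSteps.lean`),
where it replaces the appeals to Bézout's theorem in Proposition 3, Lemma 5 and the proof of
Theorem 5 of [BombieriPila1989].

## Proof

Regard `F, G` as polynomials in `y` over `k[x]`. If `deg_y F = 0` then `F ∈ k[x]` itself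
vanishes at the `x`-coordinate of every zero of `F`. Otherwise `F` is primitive (it is
irreducible of positive degree), the resultant `Res_y(F, G) ∈ k[x]` lies in the ideal `(F, G)`
(Mathlib's `Polynomial.exists_mul_add_mul_eq_C_resultant`), hence vanishes at the `x`-coordinate
of every common zero, and it is nonzero: over `K = Frac(k[x])` a vanishing resultant means that
`F` and `G` are not coprime in `K[y]` (`Polynomial.resultant_eq_zero_iff`), so the irreducible
(Gauss's lemma) `F` divides `G` in `K[y]`, hence in `k[x][y]` (Gauss's lemma again), a
contradiction. The resultant is a determinant of size `≤ d + δ` with entries of degree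
`≤ d + δ`, so its degree is `≤ (d + δ)²`. Doing the same with the variables swapped, the common
zeros lie in the product of the two root sets, of size `≤ (d + δ)⁴`.

## References

Folklore (elimination by resultants); used in place of Bézout's theorem in
* E. Bombieri, J. Pila, *The number of integral points on arcs and ovals*, Duke Math. J. 59
  (1989) 337–357 [BombieriPila1989].
-/

namespace Literature.NumberTheory.DiophantineGeometry.Dioph

open Polynomial

section Det

variable {R : Type*} [CommRing R] {n : Type*} [Fintype n] [DecidableEq n]

/-- Degree of a determinant of polynomials: if every entry has degree `≤ k` then
`deg det ≤ |n| k`. [folklore] -/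
theorem natDegree_det_le_of_forall_le (M : Matrix n n R[X]) (k : ℕ)
    (hM : ∀ i j, (M i j).natDegree ≤ k) : M.det.natDegree ≤ Fintype.card n * k := by
  rw [Matrix.det_apply']
  refine natDegree_sum_le_of_forall_le (s := Finset.univ) _ fun σ _ => ?_
  refine natDegree_mul_le.trans ?_
  have h1 : ((Equiv.Perm.sign σ : ℤ) : R[X]).natDegree = 0 := natDegree_intCast _
  rw [h1, zero_add]
  refine (natDegree_prod_le Finset.univ _).trans ?_
  calc ∑ i, (M (σ i) i).natDegree ≤ ∑ _i : n, k := Finset.sum_le_sum fun i _ => hM _ _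
    _ = Fintype.card n * k := by simp

end Det

section Field

variable {k : Type*} [Field k]

/-- Entries of the Sylvester matrix have degree bounded by that of the coefficients.
[folklore] -/
theorem natDegree_sylvester_le (F G : k[X][X]) (m n e : ℕ)
    (hF : ∀ i, (F.coeff i).natDegree ≤ e) (hG : ∀ i, (G.coeff i).natDegree ≤ e)
    (i j : Fin (m + n)) : (sylvester F G m n i j).natDegree ≤ e := by
  induction j using Fin.addCases with
  | left j => simp only [sylvester, Matrix.of_apply, Fin.addCases_left]; split_ifs <;> simp [hG]
  | right j => simp only [sylvester, Matrix.of_apply, Fin.addCases_right]; split_ifs <;> simp [hF]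

/-- **Elimination.** For `F ∈ k[x][y]` irreducible and `G` not divisible by `F`, with
`deg_y ≤ d, δ` and coefficients of degree `≤ d, δ` in `x`, there is a nonzero `R ∈ k[x]` of
degree `≤ (d + δ)²` vanishing at the `x`-coordinate of every common zero of `F` and `G`
(the resultant with respect to `y`, or `F` itself when `F ∈ k[x]`). [folklore] -/
theorem exists_eliminant {F G : k[X][X]} (hF : Irreducible F) (hFG : ¬ F ∣ G) {d δ : ℕ}
    (hFd : F.natDegree ≤ d) (hFc : ∀ i, (F.coeff i).natDegree ≤ d)
    (hGd : G.natDegree ≤ δ) (hGc : ∀ i, (G.coeff i).natDegree ≤ δ) :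
    ∃ R : k[X], R ≠ 0 ∧ R.natDegree ≤ (d + δ) * (d + δ) ∧
      ∀ x y : k, F.evalEval x y = 0 → G.evalEval x y = 0 → R.eval x = 0 := by
  by_cases hm : F.natDegree = 0
  · -- `F = C a`
    refine ⟨F.coeff 0, ?_, (hFc 0).trans (by nlinarith), fun x y hFx _ => ?_⟩
    · intro h0
      apply hF.ne_zero
      rw [Polynomial.eq_C_of_natDegree_eq_zero hm, h0, map_zero]
    · rw [Polynomial.eq_C_of_natDegree_eq_zero hm, evalEval_C] at hFx
      exact hFx
  · set m := F.natDegree with hmdef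
    set n := G.natDegree with hndef
    refine ⟨F.resultant G m n, ?_, ?_, fun x y hFx hGx => ?_⟩
    · -- nonvanishing via Gauss's lemma over `K = Frac(k[x])`
      intro hR
      have hprim : F.IsPrimitive := hF.isPrimitive hm
      let K := FractionRing k[X]
      let φ := algebraMap k[X] K
      have hφ : Function.Injective φ := IsFractionRing.injective k[X] K
      have hres : (F.map φ).resultant (G.map φ) = 0 := by
        have := resultant_map_map F G m n φ
        rw [natDegree_map_eq_of_injective hφ, natDegree_map_eq_of_injective hφ, this, hR,
          map_zero]
      rw [resultant_eq_zero_iff] at hres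
      have hirr : Irreducible (F.map φ) :=
        (hprim.irreducible_iff_irreducible_map_fraction_map (K := K)).1 hF
      have hdvd : F.map φ ∣ G.map φ := hirr.dvd_iff_not_isCoprime.2 hres.2
      exact hFG (hprim.dvd_of_fraction_map_dvd_fraction_map hdvd)
    · -- degree
      refine (natDegree_det_le_of_forall_le _ (d + δ)
        (natDegree_sylvester_le F G m n (d + δ) (fun i => (hFc i).trans (by omega))
          (fun i => (hGc i).trans (by omega)))).trans ?_
      rw [Fintype.card_fin]
      exact Nat.mul_le_mul_right _ (by omega)
    · -- in the ideal
      obtain ⟨p, q, -, -, hpq⟩ :=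
        exists_mul_add_mul_eq_C_resultant F G (le_refl m) (le_refl n) (Or.inl hm)
      have := congrArg (evalEval x y) hpq
      rw [evalEval_add, evalEval_mul, evalEval_mul, hFx, hGx, zero_mul, zero_mul, add_zero,
        evalEval_C] at this
      exact this.symm

/-! ### Swapping the variables -/

/-- Coefficients of the polynomial with swapped variables. [folklore] -/
theorem coeff_coeff_swap (F : k[X][X]) (i j : ℕ) :
    ((Bivariate.swap F).coeff i).coeff j = (F.coeff j).coeff i := by
  induction F using Polynomial.induction_on' with
  | add p q hp hq => simp only [map_add, coeff_add, hp, hq]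
  | monomial n a =>
    induction a using Polynomial.induction_on' with
    | add p q hp hq => simp only [map_add, coeff_add, hp, hq]
    | monomial m r =>
      rw [Bivariate.swap_monomial_monomial]
      simp only [coeff_monomial]
      split_ifs <;> simp_all [coeff_monomial]

/-- Evaluating the swapped polynomial. [folklore] -/
theorem evalEval_swap (F : k[X][X]) (x y : k) :
    (Bivariate.swap F).evalEval x y = F.evalEval y x := by
  rw [← coe_aevalAeval_eq_evalEval, ← coe_aevalAeval_eq_evalEval, Bivariate.aevalAeval_swap]

/-- The `y`-degree of the swapped polynomial is the `x`-degree. [folklore] -/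
theorem natDegree_swap_le {F : k[X][X]} {d : ℕ} (hFc : ∀ i, (F.coeff i).natDegree ≤ d) :
    (Bivariate.swap F).natDegree ≤ d := by
  rw [natDegree_le_iff_coeff_eq_zero]
  intro N hN
  ext j
  rw [coeff_coeff_swap, coeff_zero]
  exact coeff_eq_zero_of_natDegree_lt ((hFc j).trans_lt hN)

/-- The `x`-degree of the swapped polynomial is the `y`-degree. [folklore] -/
theorem natDegree_coeff_swap_le {F : k[X][X]} {d : ℕ} (hFd : F.natDegree ≤ d) (i : ℕ) :
    ((Bivariate.swap F).coeff i).natDegree ≤ d := by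
  rw [natDegree_le_iff_coeff_eq_zero]
  intro N hN
  rw [coeff_coeff_swap, coeff_eq_zero_of_natDegree_lt (hFd.trans_lt hN), coeff_zero]

/-! ### The weak Bézout bound -/

/-- **Weak Bézout bound** in `k[x][y]`. If `F` is irreducible and does not divide `G`, and
`F`, `G` have `y`-degree and `x`-degrees of coefficients bounded by `d`, `δ` respectively, then
the set of common zeros of `F` and `G` in `k²` is finite, of cardinality at most `(d + δ)⁴`
(Bézout's theorem gives `dδ`; the bound here comes from eliminating each variable by a
resultant and suffices wherever only a bound polynomial in the degrees is needed). [folklore] -/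
theorem commonZeros_finite_ncard_le {F G : k[X][X]} (hF : Irreducible F) (hFG : ¬ F ∣ G)
    {d δ : ℕ} (hFd : F.natDegree ≤ d) (hFc : ∀ i, (F.coeff i).natDegree ≤ d)
    (hGd : G.natDegree ≤ δ) (hGc : ∀ i, (G.coeff i).natDegree ≤ δ) :
    {p : k × k | F.evalEval p.1 p.2 = 0 ∧ G.evalEval p.1 p.2 = 0}.Finite ∧
      {p : k × k | F.evalEval p.1 p.2 = 0 ∧ G.evalEval p.1 p.2 = 0}.ncard ≤ (d + δ) ^ 4 := by
  classical
  obtain ⟨Rx, hRx0, hRxd, hRx⟩ := exists_eliminant hF hFG hFd hFc hGd hGc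
  have hF' : Irreducible (Bivariate.swap F) := (MulEquiv.irreducible_iff Bivariate.swap).2 hF
  have hFG' : ¬ Bivariate.swap F ∣ Bivariate.swap G := by
    intro h
    apply hFG
    have := map_dvd (Bivariate.swap (R := k)) h
    rwa [Bivariate.swap_swap_apply, Bivariate.swap_swap_apply] at this
  obtain ⟨Ry, hRy0, hRyd, hRy⟩ := exists_eliminant hF' hFG' (natDegree_swap_le hFc)
    (natDegree_coeff_swap_le hFd) (natDegree_swap_le hGc) (natDegree_coeff_swap_le hGd)
  set Z := {p : k × k | F.evalEval p.1 p.2 = 0 ∧ G.evalEval p.1 p.2 = 0} with hZ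
  set T : Finset (k × k) := Rx.roots.toFinset ×ˢ Ry.roots.toFinset with hT
  have hsub : Z ⊆ ↑T := by
    rintro ⟨x, y⟩ ⟨hFx, hGx⟩
    simp only [hT, Finset.coe_product, Set.mem_prod, Finset.mem_coe, Multiset.mem_toFinset,
      mem_roots hRx0, mem_roots hRy0, IsRoot.def]
    refine ⟨hRx x y hFx hGx, hRy y x ?_ ?_⟩
    · rwa [evalEval_swap]
    · rwa [evalEval_swap]
  have hfin : Z.Finite := (Finset.finite_toSet T).subset hsub
  refine ⟨hfin, ?_⟩
  calc Z.ncard ≤ (↑T : Set (k × k)).ncard := Set.ncard_le_ncard hsub (Finset.finite_toSet T)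
    _ = T.card := Set.ncard_coe_finset T
    _ = Rx.roots.toFinset.card * Ry.roots.toFinset.card := Finset.card_product _ _
    _ ≤ Rx.natDegree * Ry.natDegree := Nat.mul_le_mul
        ((Multiset.toFinset_card_le _).trans (card_roots' Rx))
        ((Multiset.toFinset_card_le _).trans (card_roots' Ry))
    _ ≤ ((d + δ) * (d + δ)) * ((d + δ) * (d + δ)) := Nat.mul_le_mul hRxd hRyd
    _ = (d + δ) ^ 4 := by ring

end Field

/-! ### The version for `MvPolynomial (Fin 2) k` and total degree -/

section Mv

variable {k : Type*} [Field k]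

open Polynomial.Bivariate in
/-- Evaluation is compatible with `Polynomial.Bivariate.equivMvPolynomial`. [folklore] -/
theorem eval_equivMvPolynomial (p : k[X][X]) (x y : k) :
    MvPolynomial.eval ![x, y] (equivMvPolynomial k p) = p.evalEval x y := by
  rw [← coe_aevalAeval_eq_evalEval]
  change ((MvPolynomial.aeval ![x, y]).comp
    (aevalAeval (MvPolynomial.X 0) (MvPolynomial.X 1) : k[X][X] →ₐ[k] MvPolynomial (Fin 2) k)) p
    = aevalAeval x y p
  congr 1
  ext <;> simp

/-- Equality of exponent vectors on `Fin 2`. [folklore] -/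
theorem single_add_single_inj {a b c d : ℕ} :
    (Finsupp.single (0 : Fin 2) a + Finsupp.single 1 b =
        Finsupp.single 0 c + Finsupp.single 1 d) ↔ a = c ∧ b = d := by
  constructor
  · intro h
    have h0 := DFunLike.congr_fun h 0
    have h1 := DFunLike.congr_fun h 1
    simp only [Finsupp.add_apply, Finsupp.single_apply, Fin.isValue, if_true, one_ne_zero,
      if_false, add_zero, zero_ne_one, zero_add] at h0 h1
    exact ⟨h0, h1⟩
  · rintro ⟨rfl, rfl⟩; rfl

open Polynomial.Bivariate in
/-- The coefficients of `equivMvPolynomial p`. [folklore] -/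
theorem coeff_equivMvPolynomial (p : k[X][X]) (m n : ℕ) :
    MvPolynomial.coeff (Finsupp.single 0 m + Finsupp.single 1 n) (equivMvPolynomial k p) =
      (p.coeff n).coeff m := by
  induction p using Polynomial.induction_on' with
  | add p q hp hq => simp only [map_add, MvPolynomial.coeff_add, coeff_add, hp, hq]
  | monomial n' a =>
    induction a using Polynomial.induction_on' with
    | add p q hp hq => simp only [map_add, MvPolynomial.coeff_add, coeff_add, hp, hq]
    | monomial m' r =>
      have h1 : equivMvPolynomial k (monomial n' (monomial m' r)) =
          MvPolynomial.monomial (Finsupp.single 0 m' + Finsupp.single 1 n') r := by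
        rw [← C_mul_X_pow_eq_monomial, ← C_mul_X_pow_eq_monomial, C_mul, C_pow, map_mul,
          map_mul, map_pow, map_pow, equivMvPolynomial_C_C, equivMvPolynomial_C_X,
          equivMvPolynomial_X, MvPolynomial.C_mul_X_pow_eq_monomial,
          MvPolynomial.X_pow_eq_monomial, MvPolynomial.monomial_mul, mul_one]
      rw [h1, MvPolynomial.coeff_monomial, coeff_monomial]
      by_cases hn : n' = n
      · subst hn
        by_cases hm : m' = m
        · subst hm
          rw [if_pos rfl, if_pos rfl, coeff_monomial, if_pos rfl]
        · rw [if_neg, if_pos rfl, coeff_monomial, if_neg hm]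
          rw [single_add_single_inj]; tauto
      · rw [if_neg, if_neg hn, coeff_zero]
        rw [single_add_single_inj]; tauto

/-- The degree of the exponent vector `(m, n)` is `m + n`. [folklore] -/
theorem sum_single_add_single (m n : ℕ) :
    ((Finsupp.single (0 : Fin 2) m + Finsupp.single 1 n).sum fun _ e => e) = m + n := by
  rw [Finsupp.sum_add_index' (fun _ => rfl) (fun _ _ _ => rfl), Finsupp.sum_single_index rfl,
    Finsupp.sum_single_index rfl]

open Polynomial.Bivariate in
/-- A coefficient of `F` beyond the total degree vanishes. [folklore] -/
theorem coeff_coeff_symm_eq_zero (F : MvPolynomial (Fin 2) k) {m n : ℕ}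
    (h : F.totalDegree < m + n) : (((equivMvPolynomial k).symm F).coeff n).coeff m = 0 := by
  rw [← coeff_equivMvPolynomial, AlgEquiv.apply_symm_apply]
  by_contra hc
  have := MvPolynomial.le_totalDegree (MvPolynomial.mem_support_iff.2 hc)
  rw [sum_single_add_single] at this
  omega

open Polynomial.Bivariate in
/-- The `y`-degree is bounded by the total degree. [folklore] -/
theorem natDegree_symm_le (F : MvPolynomial (Fin 2) k) :
    ((equivMvPolynomial k).symm F).natDegree ≤ F.totalDegree := by
  rw [natDegree_le_iff_coeff_eq_zero]
  intro N hN
  ext m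
  rw [coeff_zero]
  exact coeff_coeff_symm_eq_zero F (by omega)

open Polynomial.Bivariate in
/-- The `x`-degree of each coefficient is bounded by the total degree. [folklore] -/
theorem natDegree_coeff_symm_le (F : MvPolynomial (Fin 2) k) (i : ℕ) :
    (((equivMvPolynomial k).symm F).coeff i).natDegree ≤ F.totalDegree := by
  rw [natDegree_le_iff_coeff_eq_zero]
  intro N hN
  exact coeff_coeff_symm_eq_zero F (by omega)

open Polynomial.Bivariate in
/-- **Weak Bézout bound for `MvPolynomial (Fin 2) k`.** If `F ∈ k[x, y]` is irreducible and
does not divide `G`, then `F` and `G` have at most `(deg F + deg G)⁴` common zeros in `k²`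
(finitely many in particular). [folklore] -/
theorem mv_commonZeros_finite_ncard_le {F G : MvPolynomial (Fin 2) k}
    (hF : Irreducible F) (hFG : ¬ F ∣ G) :
    {p : k × k | MvPolynomial.eval ![p.1, p.2] F = 0 ∧ MvPolynomial.eval ![p.1, p.2] G = 0}.Finite ∧
      {p : k × k | MvPolynomial.eval ![p.1, p.2] F = 0 ∧
        MvPolynomial.eval ![p.1, p.2] G = 0}.ncard ≤ (F.totalDegree + G.totalDegree) ^ 4 := by
  set F' := (equivMvPolynomial k).symm F with hF'
  set G' := (equivMvPolynomial k).symm G with hG'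
  have hirr : Irreducible F' := (MulEquiv.irreducible_iff (equivMvPolynomial k).symm).2 hF
  have hdvd : ¬ F' ∣ G' := by
    intro h
    apply hFG
    have := map_dvd (equivMvPolynomial k) h
    rwa [hF', hG', AlgEquiv.apply_symm_apply, AlgEquiv.apply_symm_apply] at this
  have key := commonZeros_finite_ncard_le hirr hdvd (natDegree_symm_le F)
    (natDegree_coeff_symm_le F) (natDegree_symm_le G) (natDegree_coeff_symm_le G)
  have hset : {p : k × k | MvPolynomial.eval ![p.1, p.2] F = 0 ∧
      MvPolynomial.eval ![p.1, p.2] G = 0} =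
      {p : k × k | F'.evalEval p.1 p.2 = 0 ∧ G'.evalEval p.1 p.2 = 0} := by
    ext p
    simp only [Set.mem_setOf_eq, hF', hG', ← eval_equivMvPolynomial, AlgEquiv.apply_symm_apply]
  rw [hset]
  exact key

end Mv

end Literature.NumberTheory.DiophantineGeometry.Dioph
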